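import Literature.Geometry.Lorentzian.KillingOnIntegralCurveUnique
import Literature.Geometry.Lorentzian.StationaryOrbitRadialDrift
import Literature.Geometry.Lorentzian.DocStaticUniquenessProofs
import HarnessLib

/-!
# Completeness of a `T`-commuting local Killing field on a seed domain `W = N ∪ (far part)` of a
stationary black hole: a priori compactness of its orbits

Technical completeness lemma behind the far axial seed of the crux `NonTrappingHawkingRigidity`
(summit `FinalStateConjecture`, stub `stub_farAxialSeed`).  Setting: a stationary black hole
presentation `𝓑` (`T = 𝓑.killing`, `T ≠ 0` on the d.o.c.), an equivariant Killing time `t_f` on the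
d.o.c. (Chruściel–Costa 2008, Thm. 4.5), the asymptotics of `g(T,T)` at infinity in the form "outside
the stationary orbit of a compact set, `-v < g(T,T) < -v + ε`" (Chruściel–Costa 2008, §2.1–2.2 with the
positive mass theorem; the tree's named fact `chruscielCosta2008_stationaryNormAtInfinity`), a
`T`-invariant radial function `ρ₀` of the d.o.c. (smooth, `dρ₀(T) = 0`, sub-levels = traces of
neighbourhoods of `𝓔⁺`, slabs compact modulo the flow), an open `T`-invariant `W ⊆ ⟨⟨M_ext⟩⟩`, a
Killing field `Z` ON `W` commuting with `T`, a sub-region `N ⊆ W` carrying a complete flow `Φ₀` of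
`Z` and containing a sub-level `{ρ₀ < c₁}`, and the "far" condition: every point of `W ∖ N` is
`T`-timelike and its component in the `T`-timelike region lies in `W`.  CONCLUSION: through every
point of `W` there is a whole-line integral curve of `Z` staying in `W`.

Proof (`exists_isMIntegralCurve_mem_of_apriori_isCompact`, escape lemma read on `↥W`): an orbit
through `N` is a `Φ₀`-orbit (uniqueness, `IsKillingFieldOn.eqOn_of_isMIntegralCurveOn`), bounded on
bounded times; an orbit from `x ∈ W ∖ N` never enters `N`, stays in the component of `x` in the
`T`-timelike region and on the level `{g(T,T) = g(T,T)(x)}` (`KillingOnNormInvariance.lean`), hence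
(the asymptotics exclude a neighbourhood of infinity, the sub-level `{ρ₀ < c₁} ⊆ N` a neighbourhood
of the horizon) in a slab `{c₁ ≤ ρ₀ ≤ c₂}`, compact modulo the flow; its Killing time drifts at
bounded rate (`StationaryOrbitRadialDrift.lean`), so it stays in a compact set
(`StationaryOrbitConfinement.lean`).  This is the a priori bound of Chruściel 1997, proof of
Thm. 1.1 / Chruściel–Costa 2008, proof of Thm. 4.14, in the partially analytic setting.

Everything here is proved; no definitions, no named facts.

## References
* P. T. Chruściel, Comm. Math. Phys. 189 (1997) 1–7, proof of Thm. 1.1. [Chrusciel1997]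
* P. T. Chruściel, J. L. Costa, Astérisque 321 (2008), arXiv:0806.0016, §2.1–2.2, Thm. 4.5, proof of
  Thm. 4.14. [ChruscielCosta2008]
-/

noncomputable section

open Set Filter Function Bundle TopologicalSpace VectorField Literature.Geometry.Manifold
open scoped Manifold ContDiff Topology

namespace Literature.Geometry.Lorentzian

namespace StationaryAFBlackHole

/-- **Completeness of a `T`-commuting local Killing field on a seed domain** (see the module docstring
for the setting and the proof). Chruściel 1997, proof of Thm. 1.1; Chruściel–Costa 2008, proof of
Thm. 4.14. [cite: Chrusciel1997, Thm. 1.1 (proof)] -/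
theorem exists_isMIntegralCurve_mem_of_axialSeedData (𝓑 : StationaryAFBlackHole.{0})
    [𝓑.metric.HasLeviCivita] (h4 : ∀ p ∈ 𝓑.doc, 𝓑.killing p ≠ 0)
    {v : ℝ}
    (hlev : ∀ ε : ℝ, 0 < ε → ∃ S : Set 𝓑.carrier, IsCompact S ∧ S ⊆ 𝓑.doc ∪ 𝓑.horizon ∧
      ∀ x ∈ 𝓑.doc, x ∉ stationaryOrbit 𝓑.killing S →
        -v < 𝓑.metric.val x (𝓑.killing x) (𝓑.killing x) ∧
          𝓑.metric.val x (𝓑.killing x) (𝓑.killing x) < -v + ε)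
    {tf : 𝓑.carrier → ℝ} (htfs : ContMDiffOn (𝓡 4) 𝓘(ℝ, ℝ) ((⊤ : ℕ∞) : ℕ∞ω) tf 𝓑.doc)
    (htfeq : ∀ γ : ℝ → 𝓑.carrier, IsMIntegralCurve γ 𝓑.killing → γ 0 ∈ 𝓑.doc →
      ∀ s, tf (γ s) = tf (γ 0) + s)
    {ρ₀ : 𝓑.carrier → ℝ} (hR1 : ContMDiffOn (𝓡 4) 𝓘(ℝ, ℝ) ((⊤ : ℕ∞) : ℕ∞ω) ρ₀ 𝓑.doc)
    (hR2 : ∀ x ∈ 𝓑.doc, mfderiv (𝓡 4) 𝓘(ℝ, ℝ) ρ₀ x (𝓑.killing x) = 0)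
    (hR4 : ∀ c : ℝ, 0 < c → ∃ U' : Set 𝓑.carrier, IsOpen U' ∧ 𝓑.horizon ⊆ U' ∧
      U' ∩ 𝓑.doc = {x | x ∈ 𝓑.doc ∧ ρ₀ x < c})
    (hR6 : ∀ c₀ c : ℝ, 0 < c₀ → ∃ S : Set 𝓑.carrier, IsCompact S ∧ S ⊆ 𝓑.doc ∧
      {x | x ∈ 𝓑.doc ∧ c₀ ≤ ρ₀ x ∧ ρ₀ x ≤ c} ⊆ stationaryOrbit 𝓑.killing S)
    {W N : Set 𝓑.carrier} (hWo : IsOpen W) (hWdoc : W ⊆ 𝓑.doc)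
    (hWT : ∀ γ : ℝ → 𝓑.carrier, IsMIntegralCurve γ 𝓑.killing → γ 0 ∈ W → ∀ t, γ t ∈ W)
    (hNW : N ⊆ W) {Z : Π x : 𝓑.carrier, TangentSpace (𝓡 4) x}
    (hZK : 𝓑.metric.toPseudoRiemannianMetric.IsKillingFieldOn Z W)
    (hTZ : ∀ x ∈ W, mlieBracket (𝓡 4) 𝓑.killing Z x = 0)
    {Φ₀ : ℝ → 𝓑.carrier → 𝓑.carrier}
    (hΦN : ∀ x ∈ N, Φ₀ 0 x = x ∧ (∀ s : ℝ, Φ₀ s x ∈ N) ∧ IsMIntegralCurve (fun s ↦ Φ₀ s x) Z)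
    {c₁ : ℝ} (hc₁ : 0 < c₁) (hsubN : {x | x ∈ 𝓑.doc ∧ ρ₀ x < c₁} ⊆ N)
    (hfar : ∀ x ∈ W, x ∉ N → 𝓑.metric.val x (𝓑.killing x) (𝓑.killing x) < 0 ∧
      connectedComponentIn {y | y ∈ 𝓑.doc ∧ 𝓑.metric.val y (𝓑.killing y) (𝓑.killing y) < 0} x
        ⊆ W) :
    ∀ x ∈ W, ∃ γ : ℝ → 𝓑.carrier, γ 0 = x ∧ IsMIntegralCurve γ Z ∧ ∀ s, γ s ∈ W := by
  set g := 𝓑.metric.toPseudoRiemannianMetric with hg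
  have hT : g.IsKillingField 𝓑.killing := 𝓑.isStationaryKilling.isKillingField
  have hdoc : IsOpen 𝓑.doc :=
    𝓑.isOpen_doc
      (LorentzianMetric.isOpen_chronologicalFuture_holds_of_boundaryless (g := 𝓑.metric)
        (τ := 𝓑.timeOrientation))
      (LorentzianMetric.isOpen_chronologicalPast_holds_of_boundaryless (g := 𝓑.metric)
        (τ := 𝓑.timeOrientation))
  set AT : Set 𝓑.carrier := {x | x ∈ 𝓑.doc ∧ 𝓑.metric.val x (𝓑.killing x) (𝓑.killing x) < 0}
    with hAT
  have hATo : IsOpen AT :=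
    hdoc.inter (isOpen_lt continuous_val_killing_killing continuous_const)
  haveI : LocallyConnectedSpace 𝓑.carrier :=
    ChartedSpace.locallyConnectedSpace (EuclideanSpace ℝ (Fin 4)) 𝓑.carrier
  have hcurve : ∀ (F : Set 𝓑.carrier) (γ : ℝ → 𝓑.carrier), Continuous γ → (∀ t, γ t ∈ F) →
      ∀ t, γ t ∈ connectedComponentIn F (γ 0) := fun F γ hγc hγF t ↦
    ((isPreconnected_range hγc).subset_connectedComponentIn (mem_range_self 0)
      (range_subset_iff.2 hγF)) (mem_range_self t)
  have hATT : ∀ γ : ℝ → 𝓑.carrier, IsMIntegralCurve γ 𝓑.killing → γ 0 ∈ AT → ∀ t, γ t ∈ AT :=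
    fun γ hγ h0 t ↦ ⟨mem_doc_of_isMIntegralCurve hγ h0.1 t, by
      have h := hT.val_self_apply_eq_of_isMIntegralCurve hγ t 0
      show 𝓑.metric.val (γ t) (𝓑.killing (γ t)) (𝓑.killing (γ t)) < 0
      rw [show 𝓑.metric.val (γ t) (𝓑.killing (γ t)) (𝓑.killing (γ t)) =
        g.val (γ t) (𝓑.killing (γ t)) (𝓑.killing (γ t)) from rfl, h]
      exact h0.2⟩
  refine PseudoRiemannianMetric.IsKillingFieldOn.exists_isMIntegralCurve_mem_of_apriori_isCompact
    hWo hZK fun x hx Tb ↦ ?_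
  by_cases hxN : x ∈ N
  · -- the orbit through a point of `N` is its `Φ₀`-orbit
    obtain ⟨h0, hN, hintZ⟩ := hΦN x hxN
    refine ⟨(fun s ↦ Φ₀ s x) '' Icc (-Tb) Tb, (isCompact_Icc.image hintZ.continuous),
      ?_, fun γ J hJ hJc h0J hγ0 hγ hγW t ht hTt ↦ ?_⟩
    · rintro _ ⟨s, -, rfl⟩
      exact hNW (hN s)
    · have heq : EqOn γ (fun s ↦ Φ₀ s x) J :=
        hZK.eqOn_of_isMIntegralCurveOn hWo hJ hJc h0J hγ (hintZ.isMIntegralCurveOn J) hγW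
          (fun s _ ↦ hNW (hN s)) (by rw [hγ0, h0])
      rw [heq ht]
      exact mem_image_of_mem _ (abs_le.1 hTt)
  · -- level sets of `g(T,T)` are invariant (p157760) and compact modulo `T` (F_lev + (R4)–(R6));
    -- Killing time grows at bounded rate (CC time function)
    obtain ⟨hxg, hcompW⟩ := hfar x hx hxN
    have hxAT : x ∈ AT := ⟨hWdoc hx, hxg⟩
    set gx : ℝ := 𝓑.metric.val x (𝓑.killing x) (𝓑.killing x) with hgx
    have hgx0 : gx < 0 := hxAT.2
    -- the stationary flow, the time function, the norm at infinity
    obtain ⟨θ, hθs, hθ0, hθadd, hθX, _⟩ := 𝓑.exists_stationary_flow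
    have hθc : Continuous θ := hθs.continuous
    have hθ2 : ContMDiff (𝓘(ℝ, ℝ).prod (𝓡 4)) (𝓡 4) 2 θ :=
      hθs.of_le (WithTop.coe_le_coe.mpr le_top)
    have hT1 : ContMDiff (𝓡 4) (𝓡 4).tangent 1
        (fun y ↦ (⟨y, 𝓑.killing y⟩ : TangentBundle (𝓡 4) 𝓑.carrier)) :=
      hT.contMDiff.of_le (WithTop.coe_le_coe.mpr le_top)
    have hθdoc : ∀ (t : ℝ) (a : 𝓑.carrier), a ∈ 𝓑.doc → θ (t, a) ∈ 𝓑.doc := fun t a ha ↦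
      StationaryAFBlackHole.mem_doc_of_isMIntegralCurve (hθX a) (by simpa [hθ0] using ha) t
    have hθW : ∀ (t : ℝ) (a : 𝓑.carrier), a ∈ W → θ (t, a) ∈ W := fun t a ha ↦
      hWT (fun s ↦ θ (s, a)) (hθX a) (by simpa [hθ0] using ha) t
    have htfeq' : ∀ (t : ℝ) (a : 𝓑.carrier), a ∈ 𝓑.doc → tf (θ (t, a)) = tf a + t := by
      intro t a ha
      have h := htfeq (fun s ↦ θ (s, a)) (hθX a) (by simpa [hθ0] using ha) t
      simpa [hθ0] using h
    -- (a) a compact `SF` outside whose orbit `g(T,T) ≠ gx` on the d.o.c.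
    have hSF : ∃ SF : Set 𝓑.carrier, IsCompact SF ∧ SF ⊆ 𝓑.doc ∪ 𝓑.horizon ∧
        ∀ y ∈ 𝓑.doc, y ∉ stationaryOrbit 𝓑.killing SF →
          𝓑.metric.val y (𝓑.killing y) (𝓑.killing y) ≠ gx := by
      by_cases hgv : gx ≤ -v
      · obtain ⟨SF, hSFc, hSFsub, hSF⟩ := hlev 1 one_pos
        exact ⟨SF, hSFc, hSFsub, fun y hy hyS h ↦ by have := (hSF y hy hyS).1; linarith⟩
      · push Not at hgv
        obtain ⟨SF, hSFc, hSFsub, hSF⟩ := hlev (gx + v) (by linarith)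
        exact ⟨SF, hSFc, hSFsub, fun y hy hyS h ↦ by have := (hSF y hy hyS).2; linarith⟩
    obtain ⟨SF, hSFc, hSFsub, hSFne⟩ := hSF
    -- (b) `ρ₀` is bounded on `orbit_T(SF) ∩ doc` (p160635)
    have hρbdd : ∃ c₂ : ℝ, ∀ y ∈ 𝓑.doc, y ∈ stationaryOrbit 𝓑.killing SF → ρ₀ y ≤ c₂ := by
      obtain ⟨U₁, hU₁o, hHU₁, hU₁eq⟩ := hR4 1 one_pos
      exact 𝓑.exists_bound_radial_on_stationaryOrbit hR1 hR2 hU₁o hHU₁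
        (fun y hy ↦ by rw [hU₁eq] at hy; exact hy.2) hSFc hSFsub
    obtain ⟨c₂, hc₂⟩ := hρbdd
    -- (c) the slab and the compact transversal `Sx`
    obtain ⟨Ssl, hSslc, hSsldoc, hslab'⟩ := hR6 c₁ (max c₂ c₁) hc₁
    set Ωx : Set 𝓑.carrier := connectedComponentIn AT x with hΩx
    have hΩxAT : Ωx ⊆ AT := connectedComponentIn_subset _ _
    have hΩxW : Ωx ⊆ W := hcompW
    have hΩxcl : ∀ z ∈ AT, z ∈ closure Ωx → z ∈ Ωx := by
      intro z hz hzcl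
      obtain ⟨y, hyz, hyx⟩ := mem_closure_iff.1 hzcl _ hATo.connectedComponentIn
        (mem_connectedComponentIn hz)
      have h1 := connectedComponentIn_eq hyz
      have h2 := connectedComponentIn_eq hyx
      show z ∈ connectedComponentIn AT x
      rw [h2, ← h1]
      exact mem_connectedComponentIn hz
    have hΩxT : ∀ (t : ℝ) (a : 𝓑.carrier), a ∈ Ωx → θ (t, a) ∈ Ωx := by
      intro t a ha
      have h := hcurve AT (fun s ↦ θ (s, a)) (hθX a).continuous
        (hATT _ (hθX a) (by simpa [hθ0] using hΩxAT ha)) t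
      rw [hθ0, ← connectedComponentIn_eq ha] at h
      exact h
    set Sx : Set 𝓑.carrier :=
      Ssl ∩ {y | 𝓑.metric.val y (𝓑.killing y) (𝓑.killing y) = gx} ∩ closure Ωx with hSx
    have hSxc : IsCompact Sx :=
      (hSslc.inter_right (isClosed_eq StationaryAFBlackHole.continuous_val_killing_killing
        continuous_const)).inter_right isClosed_closure
    have hSxdoc : Sx ⊆ 𝓑.doc := fun a ha ↦ hSsldoc ha.1.1
    have hSxAT : ∀ a ∈ Sx, a ∈ AT := fun a ha ↦ ⟨hSxdoc ha, by
      have h : 𝓑.metric.val a (𝓑.killing a) (𝓑.killing a) = gx := ha.1.2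
      rw [h]; exact hgx0⟩
    have hSxΩx : Sx ⊆ Ωx := fun a ha ↦ hΩxcl a (hSxAT a ha) ha.2
    have horbW : stationaryOrbit 𝓑.killing Sx ⊆ W := by
      intro y hy
      rw [stationaryOrbit_eq_iUnion_image_flow hT1 hθX hθ0] at hy
      obtain ⟨t, a, ha, rfl⟩ := by simpa only [mem_iUnion, mem_image] using hy
      exact hΩxW (hΩxT t a (hSxΩx ha))
    -- (d) the Killing-time drift `F = dt_f(Z)` is bounded on the orbit of `Sx` (p160635)
    set F : 𝓑.carrier → ℝ := fun y ↦ mfderiv (𝓡 4) 𝓘(ℝ, ℝ) tf y (Z y) with hF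
    obtain ⟨CF, hCF⟩ : ∃ CF : ℝ, ∀ y ∈ stationaryOrbit 𝓑.killing Sx, |F y| ≤ CF :=
      𝓑.exists_bound_timeDrift_on_stationaryOrbit hWo hWdoc hWT hZK.1 hTZ h4 htfs
        (fun γ hγ h0 s ↦ htfeq γ hγ h0 s) hSxc (hSxΩx.trans hΩxW)
    -- (e) confinement by Killing time
    obtain ⟨Kc, hKc, hKsub, hKmem⟩ := exists_isCompact_of_equivariant_time hT1 hθX hθ0 hθc hSxc
      (htfs.continuousOn.mono hSxdoc) (fun s' a ha ↦ htfeq' s' a (hSxdoc ha)) (|tf x| + CF * Tb)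
    refine ⟨Kc, hKc, hKsub.trans horbW, fun γ J hJ hJc h0J hγ0 hγ hγW t ht hTt ↦ ?_⟩
    -- (f) the curve avoids `N⋆`, stays in `Ωx`, on the level `gx`, in the slab
    have hγN : ∀ u ∈ J, γ u ∉ N := by
      intro u hu huN
      refine hxN ?_
      rw [← hγ0]
      exact hZK.apply_zero_mem_of_isMIntegralCurveOn_of_mem hWo hNW (fun y hy ↦ (hΦN y hy).1)
        (fun y hy s ↦ (hΦN y hy).2.1 s) (fun y hy ↦ (hΦN y hy).2.2) hJ hJc h0J hγ hγW hu huN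
    have hγΩx : ∀ u ∈ J, γ u ∈ Ωx := by
      have himg : γ '' J ⊆ AT := by
        rintro _ ⟨u, hu, rfl⟩
        exact ⟨hWdoc (hγW u hu), (hfar _ (hγW u hu) (hγN u hu)).1⟩
      have hpre : IsPreconnected (γ '' J) := hJc.isPreconnected.image γ hγ.continuousOn
      have hsub := hpre.subset_connectedComponentIn (mem_image_of_mem γ h0J) himg
      rw [hγ0] at hsub
      exact fun u hu ↦ hsub (mem_image_of_mem γ hu)
    have hγlev : ∀ u ∈ J, 𝓑.metric.val (γ u) (𝓑.killing (γ u)) (𝓑.killing (γ u)) = gx := by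
      intro u hu
      have h := hZK.val_self_self_apply_eq_of_isMIntegralCurveOn hT hWo hTZ hJ hJc hγ hγW hu h0J
      rw [hγ0] at h
      exact h
    have hγorb : ∀ u ∈ J, γ u ∈ stationaryOrbit 𝓑.killing Sx := by
      intro u hu
      have hud : γ u ∈ 𝓑.doc := hWdoc (hγW u hu)
      have hρ1 : c₁ ≤ ρ₀ (γ u) := by
        by_contra hlt
        exact hγN u hu (hsubN ⟨hud, not_le.1 hlt⟩)
      have hρ2 : ρ₀ (γ u) ≤ max c₂ c₁ := by
        have horb : γ u ∈ stationaryOrbit 𝓑.killing SF := by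
          by_contra hno
          exact hSFne (γ u) hud hno (hγlev u hu)
        exact le_trans (hc₂ _ hud horb) (le_max_left _ _)
      have hsl := hslab' ⟨hud, hρ1, hρ2⟩
      rw [stationaryOrbit_eq_iUnion_image_flow hT1 hθX hθ0] at hsl ⊢
      obtain ⟨τ, a, ha, hτa⟩ := by simpa only [mem_iUnion, mem_image] using hsl
      refine mem_iUnion.2 ⟨τ, a, ⟨⟨ha, ?_⟩, ?_⟩, hτa⟩
      · have h : 𝓑.metric.val (θ (τ, a)) (𝓑.killing (θ (τ, a))) (𝓑.killing (θ (τ, a))) =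
            𝓑.metric.val (θ (0, a)) (𝓑.killing (θ (0, a))) (𝓑.killing (θ (0, a))) :=
          hT.val_self_apply_eq_of_isMIntegralCurve (hθX a) τ 0
        rw [hθ0 a] at h
        show 𝓑.metric.val a (𝓑.killing a) (𝓑.killing a) = gx
        rw [← hγlev u hu, ← hτa]
        exact h.symm
      · have haΩ : a ∈ Ωx := by
          have h := hΩxT (-τ) (θ (τ, a)) (hτa ▸ hγΩx u hu)
          rwa [hθadd, neg_add_cancel, hθ0] at h
        exact subset_closure haΩ
    -- (g) the drift bound along the curve
    have hderiv : ∀ u ∈ J, HasDerivWithinAt (fun s ↦ tf (γ s)) (F (γ u)) J u := by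
      intro u hu
      have hγu := hγ.hasMFDerivAt_of_isOpen hJ hu
      have hvel : velocity (𝓡 4) γ u = Z (γ u) := by
        rw [velocity, hγu.mfderiv]
        exact one_smul ℝ _
      have hud : γ u ∈ 𝓑.doc := hWdoc (hγW u hu)
      have h1 := hasDerivAt_comp_curve
        ((htfs.contMDiffAt (hdoc.mem_nhds hud)).mdifferentiableAt (by simp)) hγu.mdifferentiableAt
      rw [hvel] at h1
      exact h1.hasDerivWithinAt
    have hbound : ∀ u ∈ J, ‖F (γ u)‖ ≤ CF := fun u hu ↦ by
      rw [Real.norm_eq_abs]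
      exact hCF _ (hγorb u hu)
    have hdrift := (convex_iff_ordConnected.2 hJc).norm_image_sub_le_of_norm_hasDerivWithin_le
      hderiv hbound h0J ht
    have htft : |tf (γ t)| ≤ |tf x| + CF * Tb := by
      rw [Real.norm_eq_abs, Real.norm_eq_abs, hγ0, sub_zero] at hdrift
      have h1 : |tf (γ t)| ≤ |tf x| + |tf (γ t) - tf x| := by
        have := abs_add_le (tf x) (tf (γ t) - tf x)
        simpa using this
      have h2 : CF * |t| ≤ CF * Tb := by
        have hCF0 : 0 ≤ CF := le_trans (abs_nonneg _) (hCF _ (hγorb 0 h0J))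
        exact mul_le_mul_of_nonneg_left hTt hCF0
      linarith
    exact hKmem (γ t) (hγorb t ht) htft

end StationaryAFBlackHole

end Literature.Geometry.Lorentzian

end
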